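import Literature.Topology.FourManifolds.ThickenedPlanarHandlebody
import Literature.AlgebraicTopology.Homotopy.StrongDeformationRetract
import Mathlib.Data.Real.Sign
import HarnessLib

/-!
# The double `{q(x, y) + z² = c}` of a planar domain: sheets, and lifting planar deformations

Topic `Literature/Topology/FourManifolds`; infrastructure for the fact seat
`provefact-Literature.Topology.FourManifolds.exists-cbed50d78a` (named fact (g′)
`Literature.Topology.FourManifolds.exists_marking_centralSurface_of_gkTrisection`): the boundary of a
thickened planar domain `{q(x, y) + z² ≤ c} ⊂ ℝ³` (`ThickenedPlanarHandlebody.lean`; the flower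
handlebody of `FlowerHandlebody.lean`) is the level surface

  `Z = {q(x, y) + z² = c}`                                            (`PlanarDouble.double q c`),

the **double** of the planar domain `D = {q ≤ c}` along its boundary `{q = c}` (the *seam*): over
each `u ∈ D` lie the two points `(u, ±√(c - q u))` (`PlanarDouble.upperPt`, `PlanarDouble.lowerPt`),
which coincide exactly over the seam.  To compute `π₁(Z)` by deformation retracting pieces of `Z`
onto graphs one deforms the planar domain and lifts sheetwise; this file proves that this works:

* `PlanarDouble.isStrongDeformationRetractOf_double` — **lifting lemma.**  If `ψ_t` (`t ∈ [0, 1]`)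
  deforms a set `W ⊆ {q ≤ c}` inside itself, continuously on `[0, 1] × W`, from the identity to a
  map into `K`, fixing `K` throughout and FIXING THE SEAM POINTS `W ∩ {q = c}` throughout, then
  `Z ∩ π⁻¹(K)` is a strong deformation retract of `Z ∩ π⁻¹(W)`
  (`Literature.AlgebraicTopology.Homotopy.IsStrongDeformationRetractOf`), by the lift
  `(u, ±√(c - q u)) ↦ (ψ_t u, ±√(c - q(ψ_t u)))` (`PlanarDouble.liftMap`; the sign is that of the
  third coordinate, and the lift is continuous because the third coordinate of the image tends to
  `0` at the seam, where the sign jumps — `PlanarDouble.continuousOn_sign_mul`);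
* §3: the sheets as graphs (`upperPt`/`lowerPt`: continuous, injective, meeting over the seam),
  `Z ∩ π⁻¹(W) = upperPt(W) ∪ lowerPt(W)` for `W ⊆ D` (`double_inter_preimage_eq`), hence compactness,
  closedness and path-connectedness of the double over suitable `W`
  (`isCompact_double_inter`, `isClosed_double_inter`, `isPathConnected_double_inter`).
* §4: `PlanarDouble.isStrongDeformationRetractOf_double'` — the same lifting lemma when `ψ_t`
  only maps seam points to seam points (`q u = c → q (ψ_t u) = c`) instead of fixing them; the
  lift is still continuous across the seam and stays on the double (`liftMap_mem'`).

Everything is elementary and proved; no named facts.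

## References

* A. Hatcher, *Algebraic Topology*, CUP (2002), Ch. 0, p. 2 (deformation retractions).
  [HatcherAT2002]
-/

open scoped Topology
open Set Function Filter Metric

noncomputable section

namespace Literature.Topology.FourManifolds

/-- Local notation: `𝔼 n` is the model Euclidean space `EuclideanSpace ℝ (Fin n)`. -/
local notation "𝔼 " n:arg => EuclideanSpace ℝ (Fin n)

open PlanarThickening Literature.AlgebraicTopology.Homotopy

namespace PlanarDouble

/-! ### §1 Signs -/

/-- `sign x · |x| = x`. [folklore] -/
theorem sign_mul_abs (x : ℝ) : Real.sign x * |x| = x := by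
  rcases lt_trichotomy x 0 with h | h | h
  · rw [Real.sign_of_neg h, abs_of_neg h]; ring
  · subst h; simp [Real.sign_zero]
  · rw [Real.sign_of_pos h, abs_of_pos h]; ring

/-- `sign x · sign x = 1` for `x ≠ 0`. [folklore] -/
theorem sign_mul_sign {x : ℝ} (hx : x ≠ 0) : Real.sign x * Real.sign x = 1 := by
  rcases lt_trichotomy x 0 with h | h | h
  · rw [Real.sign_of_neg h]; norm_num
  · exact absurd h hx
  · rw [Real.sign_of_pos h]; norm_num

/-- `|sign x| ≤ 1`. [folklore] -/
theorem abs_sign_le (x : ℝ) : |Real.sign x| ≤ 1 := by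
  rcases lt_trichotomy x 0 with h | h | h
  · rw [Real.sign_of_neg h]; norm_num
  · subst h; simp [Real.sign_zero]
  · rw [Real.sign_of_pos h]; norm_num

/-- Near a point where `u ≠ 0`, `sign ∘ u` is locally constant. [folklore] -/
theorem eventually_sign_eq {α : Type*} [TopologicalSpace α] {S : Set α} {u : α → ℝ} {x : α}
    (hu : ContinuousWithinAt u S x) (hx : u x ≠ 0) :
    ∀ᶠ y in 𝓝[S] x, Real.sign (u y) = Real.sign (u x) := by
  rcases lt_or_gt_of_ne hx with h | h
  · filter_upwards [hu.eventually (gt_mem_nhds h)] with y hy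
    rw [Real.sign_of_neg hy, Real.sign_of_neg h]
  · filter_upwards [hu.eventually (lt_mem_nhds h)] with y hy
    rw [Real.sign_of_pos hy, Real.sign_of_pos h]

/-- **Continuity of `sign(u) · f`** when `f` vanishes wherever `u` does. [folklore] -/
theorem continuousOn_sign_mul {α : Type*} [TopologicalSpace α] {S : Set α} {u f : α → ℝ}
    (hu : ContinuousOn u S) (hf : ContinuousOn f S) (h0 : ∀ x ∈ S, u x = 0 → f x = 0) :
    ContinuousOn (fun x => Real.sign (u x) * f x) S := by
  intro x hx
  by_cases hux : u x = 0
  · have hfx : f x = 0 := h0 x hx hux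
    rw [ContinuousWithinAt, hux, Real.sign_zero, zero_mul]
    have hf0 : Tendsto f (𝓝[S] x) (𝓝 0) := by simpa [hfx] using (hf x hx).tendsto
    refine squeeze_zero_norm (fun y => ?_) (tendsto_zero_iff_norm_tendsto_zero.1 hf0)
    rw [norm_mul, Real.norm_eq_abs]
    calc |Real.sign (u y)| * ‖f y‖ ≤ 1 * ‖f y‖ := by gcongr; exact abs_sign_le _
      _ = ‖f y‖ := one_mul _
  · have hev := eventually_sign_eq (hu x hx) hux
    have hc : ContinuousWithinAt (fun y => Real.sign (u x) * f y) S x :=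
      continuousWithinAt_const.mul (hf x hx)
    refine hc.congr_of_eventuallyEq ?_ (by simp)
    filter_upwards [hev] with y hy
    rw [hy]

/-! ### §2 The double of a planar domain and the lift of a planar deformation -/

variable {q : 𝔼 2 → ℝ} {c : ℝ} {W : Set (𝔼 2)}

/-- **The double** `{q(x, y) + z² = c}` of the planar domain `{q ≤ c}` along its boundary. [folklore] -/
def double (q : 𝔼 2 → ℝ) (c : ℝ) : Set (𝔼 3) := {p | thicken q p = c}

/-- On the double, `p₂² = c - q(π p)`. [folklore] -/
theorem sq_eq_of_mem {p : 𝔼 3} (hp : p ∈ double q c) : p 2 ^ 2 = c - q (proj p) := by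
  rw [double, mem_setOf_eq, thicken_apply] at hp; linarith

/-- On the double, `q(π p) ≤ c`. [folklore] -/
theorem apply_proj_le_of_mem {p : 𝔼 3} (hp : p ∈ double q c) : q (proj p) ≤ c := by
  have := sq_eq_of_mem hp; nlinarith [sq_nonneg (p 2)]

/-- On the double, `p₂ = 0 ↔ q(π p) = c` (seam points). [folklore] -/
theorem apply_two_eq_zero_iff {p : 𝔼 3} (hp : p ∈ double q c) : p 2 = 0 ↔ q (proj p) = c := by
  have := sq_eq_of_mem hp
  constructor
  · intro h; rw [h] at this; linarith
  · intro h; rw [h, sub_self] at this; exact pow_eq_zero_iff two_ne_zero |>.1 this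

/-- On the double, `√(c - q(π p)) = |p₂|`. [folklore] -/
theorem sqrt_eq_abs_of_mem {p : 𝔼 3} (hp : p ∈ double q c) : Real.sqrt (c - q (proj p)) = |p 2| := by
  rw [← sq_eq_of_mem hp, Real.sqrt_sq_eq_abs]

/-- **The lift** of a planar map `ψ` to the double: `(u, ±) ↦ (ψ u, ± √(c - q(ψ u)))`. [folklore] -/
def liftMap (q : 𝔼 2 → ℝ) (c : ℝ) (ψ : 𝔼 2 → 𝔼 2) (p : 𝔼 3) : 𝔼 3 :=
  lift (ψ (proj p)) + (Real.sign (p 2) * Real.sqrt (c - q (ψ (proj p)))) • ez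

/-- The projection of the lift. [folklore] -/
@[simp] theorem proj_liftMap (ψ : 𝔼 2 → 𝔼 2) (p : 𝔼 3) : proj (liftMap q c ψ p) = ψ (proj p) := by
  simp [liftMap]

/-- The third coordinate of the lift. [folklore] -/
@[simp] theorem liftMap_apply_two (ψ : 𝔼 2 → 𝔼 2) (p : 𝔼 3) :
    liftMap q c ψ p 2 = Real.sign (p 2) * Real.sqrt (c - q (ψ (proj p))) := by
  simp [liftMap]

/-- If `ψ` does not move `π p`, the lift does not move `p` (for `p` on the double). [folklore] -/
theorem liftMap_eq_self {ψ : 𝔼 2 → 𝔼 2} {p : 𝔼 3} (hp : p ∈ double q c) (h : ψ (proj p) = proj p) :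
    liftMap q c ψ p = p := by
  rw [liftMap, h, sqrt_eq_abs_of_mem hp, sign_mul_abs, lift_proj_add]

/-- **The lift stays on the double** when `ψ` maps into `{q ≤ c}` and fixes the seam points.
[folklore] -/
theorem liftMap_mem {ψ : 𝔼 2 → 𝔼 2} {p : 𝔼 3} (hp : p ∈ double q c) (hle : q (ψ (proj p)) ≤ c)
    (hseam : q (proj p) = c → ψ (proj p) = proj p) : liftMap q c ψ p ∈ double q c := by
  by_cases h2 : p 2 = 0
  · rw [liftMap_eq_self hp (hseam ((apply_two_eq_zero_iff hp).1 h2))]; exact hp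
  · rw [double, mem_setOf_eq, thicken_apply, proj_liftMap, liftMap_apply_two, mul_pow, sq,
      sign_mul_sign h2, one_mul, Real.sq_sqrt (by linarith)]
    ring

/-- **Lifting a planar strong deformation retraction to the double.**  Let `ψ_t` (`t ∈ [0, 1]`) be
a deformation of a set `W ⊆ {q ≤ c}` into itself, continuous on `[0, 1] × W`, starting at the
identity, ending in `K`, fixing `K` throughout, and FIXING THE SEAM `W ∩ {q = c}` throughout.  Then
over `W` the double `{q + z² = c}` strong deformation retracts onto its part over `K`: lift
`ψ_t` sheetwise, `(u, ±√(c - q u)) ↦ (ψ_t u, ±√(c - q(ψ_t u)))`. [folklore] -/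
theorem isStrongDeformationRetractOf_double (hq : Continuous q) {W K : Set (𝔼 2)}
    (ψ : ℝ → 𝔼 2 → 𝔼 2) (hcont : ContinuousOn (fun x : ℝ × 𝔼 2 => ψ x.1 x.2) (Icc (0 : ℝ) 1 ×ˢ W))
    (hmaps : ∀ t ∈ Icc (0 : ℝ) 1, MapsTo (ψ t) W W) (hsub : ∀ u ∈ W, q u ≤ c)
    (hseam : ∀ t ∈ Icc (0 : ℝ) 1, ∀ u ∈ W, q u = c → ψ t u = u)
    (h0 : ∀ u ∈ W, ψ 0 u = u) (h1 : ∀ u ∈ W, ψ 1 u ∈ K)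
    (hfix : ∀ t ∈ Icc (0 : ℝ) 1, ∀ u ∈ W, u ∈ K → ψ t u = u) :
    IsStrongDeformationRetractOf (double q c ∩ proj ⁻¹' K) (double q c ∩ proj ⁻¹' W) := by
  refine IsStrongDeformationRetractOf.of_continuousOn (fun t p => liftMap q c (ψ t) p) ?_ ?_ ?_ ?_ ?_
  · -- continuity on `[0, 1] × (double over W)`
    have hφ : ContinuousOn (fun x : ℝ × 𝔼 3 => ψ x.1 (proj x.2))
        (Icc (0 : ℝ) 1 ×ˢ (double q c ∩ proj ⁻¹' W)) := by
      refine hcont.comp (continuous_fst.prodMk (proj.continuous.comp continuous_snd)).continuousOn ?_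
      rintro ⟨t, p⟩ ⟨ht, -, hp⟩
      exact ⟨ht, hp⟩
    have hroot : ContinuousOn (fun x : ℝ × 𝔼 3 => Real.sqrt (c - q (ψ x.1 (proj x.2))))
        (Icc (0 : ℝ) 1 ×ˢ (double q c ∩ proj ⁻¹' W)) :=
      Real.continuous_sqrt.comp_continuousOn (continuousOn_const.sub (hq.comp_continuousOn hφ))
    have hz : ContinuousOn (fun x : ℝ × 𝔼 3 => x.2 2) (Icc (0 : ℝ) 1 ×ˢ (double q c ∩ proj ⁻¹' W)) :=
      ((EuclideanSpace.proj (2 : Fin 3)).continuous.comp continuous_snd).continuousOn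
    have hscal := continuousOn_sign_mul hz hroot (by
      rintro ⟨t, p⟩ ⟨ht, hp, hpW⟩ h2
      simp only at h2 ⊢
      have hseam' : q (proj p) = c := (apply_two_eq_zero_iff hp).1 h2
      rw [hseam t ht (proj p) hpW hseam', hseam', sub_self, Real.sqrt_zero])
    simp only [liftMap]
    exact (lift.continuous.comp_continuousOn hφ).add (hscal.smul continuousOn_const)
  · rintro t ht p ⟨hp, hpW⟩
    refine ⟨liftMap_mem hp ?_ (hseam t ht _ hpW), ?_⟩
    · exact hsub _ (hmaps t ht hpW)
    · show proj (liftMap q c (ψ t) p) ∈ W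
      rw [proj_liftMap]; exact hmaps t ht hpW
  · rintro p ⟨hp, hpW⟩
    exact liftMap_eq_self hp (h0 _ hpW)
  · rintro p ⟨hp, hpW⟩
    refine ⟨liftMap_mem hp (hsub _ (hmaps 1 ⟨zero_le_one, le_rfl⟩ hpW))
      (hseam 1 ⟨zero_le_one, le_rfl⟩ _ hpW), ?_⟩
    show proj (liftMap q c (ψ 1) p) ∈ K
    rw [proj_liftMap]; exact h1 _ hpW
  · rintro t ht p ⟨hp, hpW⟩ ⟨-, hpK⟩
    exact liftMap_eq_self hp (hfix t ht _ hpW hpK)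


/-! ### §3 The two sheets as graphs -/

/-- **The upper sheet** `u ↦ (u, +√(c - q u))`. [folklore] -/
def upperPt (q : 𝔼 2 → ℝ) (c : ℝ) (u : 𝔼 2) : 𝔼 3 := lift u + Real.sqrt (c - q u) • ez

/-- **The lower sheet** `u ↦ (u, -√(c - q u))`. [folklore] -/
def lowerPt (q : 𝔼 2 → ℝ) (c : ℝ) (u : 𝔼 2) : 𝔼 3 := lift u + (-Real.sqrt (c - q u)) • ez

/-- `π ∘ upperPt = id`. [folklore] -/
@[simp] theorem proj_upperPt (u : 𝔼 2) : proj (upperPt q c u) = u := by simp [upperPt]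

/-- `π ∘ lowerPt = id`. [folklore] -/
@[simp] theorem proj_lowerPt (u : 𝔼 2) : proj (lowerPt q c u) = u := by simp [lowerPt]

/-- The third coordinate of the upper sheet. [folklore] -/
@[simp] theorem upperPt_apply_two (u : 𝔼 2) : upperPt q c u 2 = Real.sqrt (c - q u) := by simp [upperPt]

/-- The third coordinate of the lower sheet. [folklore] -/
@[simp] theorem lowerPt_apply_two (u : 𝔼 2) : lowerPt q c u 2 = -Real.sqrt (c - q u) := by simp [lowerPt]

/-- The upper sheet is injective. [folklore] -/
theorem upperPt_injective : Injective (upperPt q c) := fun u v h => by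
  rw [← proj_upperPt (q := q) (c := c) u, h, proj_upperPt]

/-- The lower sheet is injective. [folklore] -/
theorem lowerPt_injective : Injective (lowerPt q c) := fun u v h => by
  rw [← proj_lowerPt (q := q) (c := c) u, h, proj_lowerPt]

/-- The upper sheet is continuous (for continuous `q`). [folklore] -/
theorem continuous_upperPt (hq : Continuous q) : Continuous (upperPt q c) := by
  unfold upperPt; fun_prop

/-- The lower sheet is continuous (for continuous `q`). [folklore] -/
theorem continuous_lowerPt (hq : Continuous q) : Continuous (lowerPt q c) := by
  unfold lowerPt; fun_prop

/-- Points of the upper sheet over `{q ≤ c}` lie on the double. [folklore] -/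
theorem upperPt_mem {u : 𝔼 2} (hu : q u ≤ c) : upperPt q c u ∈ double q c := by
  rw [double, mem_setOf_eq, thicken_apply, proj_upperPt, upperPt_apply_two, Real.sq_sqrt (by linarith)]
  ring

/-- Points of the lower sheet over `{q ≤ c}` lie on the double. [folklore] -/
theorem lowerPt_mem {u : 𝔼 2} (hu : q u ≤ c) : lowerPt q c u ∈ double q c := by
  rw [double, mem_setOf_eq, thicken_apply, proj_lowerPt, lowerPt_apply_two, neg_sq,
    Real.sq_sqrt (by linarith)]
  ring

/-- A point of the double with `p₂ ≥ 0` is on the upper sheet. [folklore] -/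
theorem eq_upperPt_of_mem {p : 𝔼 3} (hp : p ∈ double q c) (h : 0 ≤ p 2) : p = upperPt q c (proj p) := by
  rw [upperPt, sqrt_eq_abs_of_mem hp, abs_of_nonneg h, lift_proj_add]

/-- A point of the double with `p₂ ≤ 0` is on the lower sheet. [folklore] -/
theorem eq_lowerPt_of_mem {p : 𝔼 3} (hp : p ∈ double q c) (h : p 2 ≤ 0) : p = lowerPt q c (proj p) := by
  rw [lowerPt, sqrt_eq_abs_of_mem hp, abs_of_nonpos h, neg_neg, lift_proj_add]

/-- On the seam the two sheets meet: `q u = c → upperPt u = lowerPt u`. [folklore] -/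
theorem upperPt_eq_lowerPt {u : 𝔼 2} (hu : q u = c) : upperPt q c u = lowerPt q c u := by
  rw [upperPt, lowerPt, hu, sub_self, Real.sqrt_zero, neg_zero]

/-- On the seam, `upperPt u = lift u`. [folklore] -/
theorem upperPt_eq_lift {u : 𝔼 2} (hu : q u = c) : upperPt q c u = lift u := by
  rw [upperPt, hu, sub_self, Real.sqrt_zero, zero_smul, add_zero]

/-- **The double over a set `W ⊆ {q ≤ c}` is the union of the two sheets over `W`.** [folklore] -/
theorem double_inter_preimage_eq (hW : ∀ u ∈ W, q u ≤ c) :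
    double q c ∩ proj ⁻¹' W = upperPt q c '' W ∪ lowerPt q c '' W := by
  ext p
  constructor
  · rintro ⟨hp, hpW⟩
    rcases le_total 0 (p 2) with h | h
    · exact Or.inl ⟨proj p, hpW, (eq_upperPt_of_mem hp h).symm⟩
    · exact Or.inr ⟨proj p, hpW, (eq_lowerPt_of_mem hp h).symm⟩
  · rintro (⟨u, hu, rfl⟩ | ⟨u, hu, rfl⟩)
    · exact ⟨upperPt_mem (hW u hu), by simpa using hu⟩
    · exact ⟨lowerPt_mem (hW u hu), by simpa using hu⟩

/-- The double over a compact `W ⊆ {q ≤ c}` is compact (for continuous `q`). [folklore] -/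
theorem isCompact_double_inter (hq : Continuous q) {W : Set (𝔼 2)} (hWc : IsCompact W)
    (hW : ∀ u ∈ W, q u ≤ c) : IsCompact (double q c ∩ proj ⁻¹' W) := by
  rw [double_inter_preimage_eq hW]
  exact (hWc.image (continuous_upperPt hq)).union (hWc.image (continuous_lowerPt hq))

/-- The double is closed (for continuous `q`). [folklore] -/
theorem isClosed_double (hq : Continuous q) : IsClosed (double q c) := by
  have : Continuous (thicken q) := by unfold thicken; fun_prop
  exact isClosed_eq this continuous_const

/-- The double over a closed set is closed (for continuous `q`). [folklore] -/
theorem isClosed_double_inter (hq : Continuous q) {W : Set (𝔼 2)} (hW : IsClosed W) :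
    IsClosed (double q c ∩ proj ⁻¹' W) :=
  (isClosed_double hq).inter (hW.preimage proj.continuous)

/-- The double over a path-connected `W ⊆ {q ≤ c}` meeting the seam is path connected: both sheets
are path connected and they meet over `W ∩ {q = c}`. [folklore] -/
theorem isPathConnected_double_inter (hq : Continuous q) {W : Set (𝔼 2)} (hWp : IsPathConnected W)
    (hW : ∀ u ∈ W, q u ≤ c) (hseam : ∃ u ∈ W, q u = c) : IsPathConnected (double q c ∩ proj ⁻¹' W) := by
  rw [double_inter_preimage_eq hW]
  obtain ⟨u, hu, hqu⟩ := hseam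
  exact IsPathConnected.union (hWp.image (continuous_upperPt hq)) (hWp.image (continuous_lowerPt hq))
    ⟨upperPt q c u, ⟨u, hu, rfl⟩, ⟨u, hu, (upperPt_eq_lowerPt hqu).symm⟩⟩


/-! ### §4 Lifting deformations that only preserve the seam -/

/-- **The lift stays on the double** when `ψ` maps into `{q ≤ c}` and maps seam points to seam
points (it need not fix them). [folklore] -/
theorem liftMap_mem' {ψ : 𝔼 2 → 𝔼 2} {p : 𝔼 3} (hp : p ∈ double q c) (hle : q (ψ (proj p)) ≤ c)
    (hseam : q (proj p) = c → q (ψ (proj p)) = c) : liftMap q c ψ p ∈ double q c := by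
  by_cases h2 : p 2 = 0
  · have hc : q (ψ (proj p)) = c := hseam ((apply_two_eq_zero_iff hp).1 h2)
    rw [double, mem_setOf_eq, thicken_apply, proj_liftMap, liftMap_apply_two, h2, Real.sign_zero,
      zero_mul, hc]
    ring
  · rw [double, mem_setOf_eq, thicken_apply, proj_liftMap, liftMap_apply_two, mul_pow, sq,
      sign_mul_sign h2, one_mul, Real.sq_sqrt (by linarith)]
    ring

/-- **Lifting a seam-preserving planar strong deformation retraction to the double.**  As
`isStrongDeformationRetractOf_double`, but the deformation `ψ_t` is only required to map seam
points of `W` (`q = c`) to seam points, not to fix them: the lift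
`(u, ±√(c - q u)) ↦ (ψ_t u, ±√(c - q(ψ_t u)))` is still continuous across the seam (both signs
give height `0` there) and stays on the double.  Used for collars of the valley arcs, whose
deformations slide along the boundary of the flower domain. [folklore] -/
theorem isStrongDeformationRetractOf_double' (hq : Continuous q) {W K : Set (𝔼 2)}
    (ψ : ℝ → 𝔼 2 → 𝔼 2) (hcont : ContinuousOn (fun x : ℝ × 𝔼 2 => ψ x.1 x.2) (Icc (0 : ℝ) 1 ×ˢ W))
    (hmaps : ∀ t ∈ Icc (0 : ℝ) 1, MapsTo (ψ t) W W) (hsub : ∀ u ∈ W, q u ≤ c)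
    (hseam : ∀ t ∈ Icc (0 : ℝ) 1, ∀ u ∈ W, q u = c → q (ψ t u) = c)
    (h0 : ∀ u ∈ W, ψ 0 u = u) (h1 : ∀ u ∈ W, ψ 1 u ∈ K)
    (hfix : ∀ t ∈ Icc (0 : ℝ) 1, ∀ u ∈ W, u ∈ K → ψ t u = u) :
    IsStrongDeformationRetractOf (double q c ∩ proj ⁻¹' K) (double q c ∩ proj ⁻¹' W) := by
  refine IsStrongDeformationRetractOf.of_continuousOn (fun t p => liftMap q c (ψ t) p) ?_ ?_ ?_ ?_ ?_
  · -- continuity on `[0, 1] × (double over W)`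
    have hφ : ContinuousOn (fun x : ℝ × 𝔼 3 => ψ x.1 (proj x.2))
        (Icc (0 : ℝ) 1 ×ˢ (double q c ∩ proj ⁻¹' W)) := by
      refine hcont.comp (continuous_fst.prodMk (proj.continuous.comp continuous_snd)).continuousOn ?_
      rintro ⟨t, p⟩ ⟨ht, -, hp⟩
      exact ⟨ht, hp⟩
    have hroot : ContinuousOn (fun x : ℝ × 𝔼 3 => Real.sqrt (c - q (ψ x.1 (proj x.2))))
        (Icc (0 : ℝ) 1 ×ˢ (double q c ∩ proj ⁻¹' W)) :=
      Real.continuous_sqrt.comp_continuousOn (continuousOn_const.sub (hq.comp_continuousOn hφ))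
    have hz : ContinuousOn (fun x : ℝ × 𝔼 3 => x.2 2) (Icc (0 : ℝ) 1 ×ˢ (double q c ∩ proj ⁻¹' W)) :=
      ((EuclideanSpace.proj (2 : Fin 3)).continuous.comp continuous_snd).continuousOn
    have hscal := continuousOn_sign_mul hz hroot (by
      rintro ⟨t, p⟩ ⟨ht, hp, hpW⟩ h2
      simp only at h2 ⊢
      have hseam' : q (proj p) = c := (apply_two_eq_zero_iff hp).1 h2
      rw [hseam t ht (proj p) hpW hseam', sub_self, Real.sqrt_zero])
    simp only [liftMap]
    exact (lift.continuous.comp_continuousOn hφ).add (hscal.smul continuousOn_const)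
  · rintro t ht p ⟨hp, hpW⟩
    refine ⟨liftMap_mem' hp ?_ (hseam t ht _ hpW), ?_⟩
    · exact hsub _ (hmaps t ht hpW)
    · show proj (liftMap q c (ψ t) p) ∈ W
      rw [proj_liftMap]; exact hmaps t ht hpW
  · rintro p ⟨hp, hpW⟩
    exact liftMap_eq_self hp (h0 _ hpW)
  · rintro p ⟨hp, hpW⟩
    refine ⟨liftMap_mem' hp (hsub _ (hmaps 1 ⟨zero_le_one, le_rfl⟩ hpW))
      (hseam 1 ⟨zero_le_one, le_rfl⟩ _ hpW), ?_⟩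
    show proj (liftMap q c (ψ 1) p) ∈ K
    rw [proj_liftMap]; exact h1 _ hpW
  · rintro t ht p ⟨hp, hpW⟩ ⟨-, hpK⟩
    exact liftMap_eq_self hp (hfix t ht _ hpW hpK)

end PlanarDouble

end Literature.Topology.FourManifolds
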